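import Mathlib
import Summits.Ventures.PercRepro2.Tail2DBlockCalc
import Summits.Ventures.PercRepro2.Tail2DHarrisSP
import Summits.Ventures.PercRepro2.Tail2DFlowOneBlocks

/-!
# Three flow-one networks in parallel: the tails of `(s ∥ t) ∥ r` as unions of product blocks, and their counts
(seat mine-b, cell pub-perc-repro2; conjectures/MINE-B.md §43)

For three flow-one networks `s, t, r` the labels of `Z = (s ∥ t) ∥ r` are sums of three letters `R = (1,0)`,
`B = (0,1)`, `C = (0,0)`, so every tail is a union of product blocks of the Harris blocks `R, B, C, row, col, all`
of the factors.  Here: the counts `#C + #R = #col`, `#all = 2#R + #C`, the membership of a configuration of `Z` in a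
tail by its three letters (`mem_tailSet_par3`), the tails `E(3,0), E(0,3), E(2,1), E(1,2), E(2,0), E(0,2)` as
disjoint unions of product blocks with their counts, the inclusion–exclusion count of `E(1,1)`
(`tailCount_par3_11_add`: `#E(1,1) + 2 #col³ = #all³ + #C³`), the emptiness of the tails beyond the total flow `3`,
and the membership / cardinality lemmas for product blocks of `s ∥ t` taken on the configuration type of `s ∥ t`
(so that they match the blocks of a certificate on `Z`).  `Tail2DFlowOneThreeCerts.lean` and
`Tail2DFlowOneThreeTwenty.lean` build the certificates on these blocks; `Tail2DFlowOneThree.lean` assembles (SD).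
-/

namespace Summit.Ventures.PercRepro2.Tail2D

open V2Closure Finset

section Counts

variable (s : V2Closure.SP)

/-- the cell `{r = 0, b = 0}` is the column without the blue crossings -/
theorem cellSet_eq_sdiff (hs : FlowOne s) : cellSet s = colSet s \ bSet s := by
  ext x
  rw [Finset.mem_sdiff, mem_cellSet, mem_colSet, mem_bSet]
  have := hs x; omega

/-- `#C + #R = #col` (flow one) -/
theorem card_cellSet_add (hs : FlowOne s) : (cellSet s).card + (rSet s).card = (colSet s).card := by
  have hsub : bSet s ⊆ colSet s := by
    intro x hx; rw [mem_bSet] at hx; rw [mem_colSet]; have := hs x; omega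
  have h := Finset.card_le_card hsub
  rw [cellSet_eq_sdiff s hs, Finset.card_sdiff_of_subset hsub, card_bSet_eq]
  rw [card_bSet_eq] at h
  omega

/-- `#all = 2 #R + #C` (flow one) -/
theorem card_conf_eq (hs : FlowOne s) : Fintype.card s.Conf = 2 * (rSet s).card + (cellSet s).card := by
  have h1 := card_colSet s hs
  have h2 := card_cellSet_add s hs
  have h3 := card_rSet_le s
  omega

/-- `#col = #R + #C` -/
theorem card_colSet' (hs : FlowOne s) : (colSet s).card = (rSet s).card + (cellSet s).card := by
  have := card_cellSet_add s hs; omega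

/-- `#row = #R + #C` -/
theorem card_rowSet0' (hs : FlowOne s) : (rowSet s 0).card = (rSet s).card + (cellSet s).card := by
  rw [card_rowSet0, card_conf_eq s hs]; omega

/-- the red flow of a parallel composition, on a pair -/
theorem rLab_par_mk (s t : V2Closure.SP) (x : s.Conf) (y : t.Conf) :
    (V2Closure.SP.par s t).rLab (x, y) = s.rLab x + t.rLab y := rfl

/-- the blue flow of a parallel composition, on a pair -/
theorem bLab_par_mk (s t : V2Closure.SP) (x : s.Conf) (y : t.Conf) :
    (V2Closure.SP.par s t).bLab (x, y) = s.bLab x + t.bLab y := rfl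

end Counts

section Three

variable (s t r : V2Closure.SP)

/-- the three-letter label of a configuration of `(s ∥ t) ∥ r` -/
theorem mem_tailSet_par3 (a c : ℕ) (p : (V2Closure.SP.par (V2Closure.SP.par s t) r).Conf) :
    p ∈ tailSet (V2Closure.SP.par (V2Closure.SP.par s t) r) a c ↔
      a ≤ s.rLab p.1.1 + t.rLab p.1.2 + r.rLab p.2 ∧ c ≤ s.bLab p.1.1 + t.bLab p.1.2 + r.bLab p.2 := by
  rw [mem_tailSet_par' (V2Closure.SP.par s t) r a c p]
  exact Iff.rfl

/-- beyond the total flow `3` the tails are empty -/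
theorem tailCount_par3_big (hs : FlowOne s) (ht : FlowOne t) (hr : FlowOne r) (a c : ℕ) (h : 4 ≤ a + c) :
    tailCount (V2Closure.SP.par (V2Closure.SP.par s t) r) a c = 0 := by
  rw [tailCount_eq_card, Finset.card_eq_zero, Finset.eq_empty_iff_forall_notMem]
  intro p hp
  rw [mem_tailSet_par3] at hp
  have := hs p.1.1; have := ht p.1.2; have := hr p.2; omega

/-- the tail `E(3,0)`: all three red -/
theorem tailSet_par3_30 (hs : FlowOne s) (ht : FlowOne t) (hr : FlowOne r) :
    tailSet (V2Closure.SP.par (V2Closure.SP.par s t) r) 3 0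
      = ((rSet s ×ˢ rSet t : Finset (s.Conf × t.Conf)) ×ˢ rSet r : Finset ((s.Conf × t.Conf) × r.Conf)) := by
  apply Finset.ext; intro p
  rw [mem_tailSet_par3]
  refine Iff.trans ?_ Finset.mem_product.symm
  refine Iff.trans ?_ (and_congr Finset.mem_product Iff.rfl).symm
  rw [mem_rSet, mem_rSet, mem_rSet]
  have := hs p.1.1; have := ht p.1.2; have := hr p.2; omega

/-- `#E(3,0) = a₁ a₂ a₃` -/
theorem tailCount_par3_30 (hs : FlowOne s) (ht : FlowOne t) (hr : FlowOne r) :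
    tailCount (V2Closure.SP.par (V2Closure.SP.par s t) r) 3 0 = (rSet s).card * (rSet t).card * (rSet r).card := by
  rw [tailCount_eq_card, tailSet_par3_30 s t r hs ht hr]
  show ((rSet s ×ˢ rSet t : Finset (s.Conf × t.Conf)) ×ˢ rSet r : Finset ((s.Conf × t.Conf) × r.Conf)).card = _
  rw [Finset.card_product, Finset.card_product]

/-- the tail `E(0,3)`: all three blue -/
theorem tailSet_par3_03 (hs : FlowOne s) (ht : FlowOne t) (hr : FlowOne r) :
    tailSet (V2Closure.SP.par (V2Closure.SP.par s t) r) 0 3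
      = ((bSet s ×ˢ bSet t : Finset (s.Conf × t.Conf)) ×ˢ bSet r : Finset ((s.Conf × t.Conf) × r.Conf)) := by
  apply Finset.ext; intro p
  rw [mem_tailSet_par3]
  refine Iff.trans ?_ Finset.mem_product.symm
  refine Iff.trans ?_ (and_congr Finset.mem_product Iff.rfl).symm
  rw [mem_bSet, mem_bSet, mem_bSet]
  have := hs p.1.1; have := ht p.1.2; have := hr p.2; omega

/-- `#E(0,3) = a₁ a₂ a₃` -/
theorem tailCount_par3_03 (hs : FlowOne s) (ht : FlowOne t) (hr : FlowOne r) :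
    tailCount (V2Closure.SP.par (V2Closure.SP.par s t) r) 0 3 = (rSet s).card * (rSet t).card * (rSet r).card := by
  rw [tailCount_eq_card, tailSet_par3_03 s t r hs ht hr]
  show ((bSet s ×ˢ bSet t : Finset (s.Conf × t.Conf)) ×ˢ bSet r : Finset ((s.Conf × t.Conf) × r.Conf)).card = _
  rw [Finset.card_product, Finset.card_product, card_bSet_eq, card_bSet_eq, card_bSet_eq]

/-- the tail `E(2,1)`: two red, one blue — the three words `RRB, RBR, BRR` -/
theorem tailSet_par3_21 (hs : FlowOne s) (ht : FlowOne t) (hr : FlowOne r) :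
    tailSet (V2Closure.SP.par (V2Closure.SP.par s t) r) 2 1
      = (((rSet s ×ˢ rSet t : Finset (s.Conf × t.Conf)) ×ˢ bSet r : Finset ((s.Conf × t.Conf) × r.Conf))
          ∪ ((rSet s ×ˢ bSet t : Finset (s.Conf × t.Conf)) ×ˢ rSet r : Finset ((s.Conf × t.Conf) × r.Conf)))
          ∪ ((bSet s ×ˢ rSet t : Finset (s.Conf × t.Conf)) ×ˢ rSet r : Finset ((s.Conf × t.Conf) × r.Conf)) := by
  apply Finset.ext; intro p
  rw [mem_tailSet_par3]
  refine Iff.trans ?_ Finset.mem_union.symm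
  refine Iff.trans ?_ (or_congr Finset.mem_union Iff.rfl).symm
  refine Iff.trans ?_ (or_congr (or_congr Finset.mem_product Finset.mem_product) Finset.mem_product).symm
  refine Iff.trans ?_ (or_congr (or_congr (and_congr Finset.mem_product Iff.rfl) (and_congr Finset.mem_product Iff.rfl))
    (and_congr Finset.mem_product Iff.rfl)).symm
  simp only [mem_rSet, mem_bSet]
  have := hs p.1.1; have := ht p.1.2; have := hr p.2
  omega

/-- `#E(2,1) = 3 a₁ a₂ a₃` -/
theorem tailCount_par3_21 (hs : FlowOne s) (ht : FlowOne t) (hr : FlowOne r) :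
    tailCount (V2Closure.SP.par (V2Closure.SP.par s t) r) 2 1
      = 3 * ((rSet s).card * (rSet t).card * (rSet r).card) := by
  rw [tailCount_eq_card, tailSet_par3_21 s t r hs ht hr]
  show ((((rSet s ×ˢ rSet t : Finset (s.Conf × t.Conf)) ×ˢ bSet r : Finset ((s.Conf × t.Conf) × r.Conf))
          ∪ ((rSet s ×ˢ bSet t : Finset (s.Conf × t.Conf)) ×ˢ rSet r : Finset ((s.Conf × t.Conf) × r.Conf)))
          ∪ ((bSet s ×ˢ rSet t : Finset (s.Conf × t.Conf)) ×ˢ rSet r : Finset ((s.Conf × t.Conf) × r.Conf))).card = _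
  rw [Finset.card_union_of_disjoint, Finset.card_union_of_disjoint]
  · simp only [Finset.card_product, card_bSet_eq]; ring
  · rw [Finset.disjoint_left]; rintro ⟨⟨x, y⟩, z⟩ h1 h2
    simp only [Finset.mem_product, mem_rSet, mem_bSet] at h1 h2
    have := hs x; have := ht y; have := hr z; omega
  · rw [Finset.disjoint_left]; rintro ⟨⟨x, y⟩, z⟩ h1 h2
    simp only [Finset.mem_union, Finset.mem_product, mem_rSet, mem_bSet] at h1 h2
    have := hs x; have := ht y; have := hr z; omega

/-- `#E(1,2) = 3 a₁ a₂ a₃` (the colour swap) -/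
theorem tailCount_par3_12 (hs : FlowOne s) (ht : FlowOne t) (hr : FlowOne r) :
    tailCount (V2Closure.SP.par (V2Closure.SP.par s t) r) 1 2
      = 3 * ((rSet s).card * (rSet t).card * (rSet r).card) := by
  rw [tailCount_symm, tailCount_par3_21 s t r hs ht hr]

/-- the tail `E(1,2)`: the three words `RBB, BRB, BBR` -/
theorem tailSet_par3_12 (hs : FlowOne s) (ht : FlowOne t) (hr : FlowOne r) :
    tailSet (V2Closure.SP.par (V2Closure.SP.par s t) r) 1 2
      = (((rSet s ×ˢ bSet t : Finset (s.Conf × t.Conf)) ×ˢ bSet r : Finset ((s.Conf × t.Conf) × r.Conf))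
          ∪ ((bSet s ×ˢ rSet t : Finset (s.Conf × t.Conf)) ×ˢ bSet r : Finset ((s.Conf × t.Conf) × r.Conf)))
          ∪ ((bSet s ×ˢ bSet t : Finset (s.Conf × t.Conf)) ×ˢ rSet r : Finset ((s.Conf × t.Conf) × r.Conf)) := by
  apply Finset.ext; intro p
  rw [mem_tailSet_par3]
  refine Iff.trans ?_ Finset.mem_union.symm
  refine Iff.trans ?_ (or_congr Finset.mem_union Iff.rfl).symm
  refine Iff.trans ?_ (or_congr (or_congr Finset.mem_product Finset.mem_product) Finset.mem_product).symm
  refine Iff.trans ?_ (or_congr (or_congr (and_congr Finset.mem_product Iff.rfl) (and_congr Finset.mem_product Iff.rfl))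
    (and_congr Finset.mem_product Iff.rfl)).symm
  simp only [mem_rSet, mem_bSet]
  have := hs p.1.1; have := ht p.1.2; have := hr p.2
  omega

/-- the tail `E(2,0)`: the first two reds — `RR·, R col R, col R R` -/
theorem tailSet_par3_20 (hs : FlowOne s) (ht : FlowOne t) (hr : FlowOne r) :
    tailSet (V2Closure.SP.par (V2Closure.SP.par s t) r) 2 0
      = (((rSet s ×ˢ rSet t : Finset (s.Conf × t.Conf)) ×ˢ (Finset.univ : Finset r.Conf)
            : Finset ((s.Conf × t.Conf) × r.Conf))
          ∪ ((rSet s ×ˢ colSet t : Finset (s.Conf × t.Conf)) ×ˢ rSet r : Finset ((s.Conf × t.Conf) × r.Conf)))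
          ∪ ((colSet s ×ˢ rSet t : Finset (s.Conf × t.Conf)) ×ˢ rSet r : Finset ((s.Conf × t.Conf) × r.Conf)) := by
  apply Finset.ext; intro p
  rw [mem_tailSet_par3]
  refine Iff.trans ?_ Finset.mem_union.symm
  refine Iff.trans ?_ (or_congr Finset.mem_union Iff.rfl).symm
  refine Iff.trans ?_ (or_congr (or_congr Finset.mem_product Finset.mem_product) Finset.mem_product).symm
  refine Iff.trans ?_ (or_congr (or_congr (and_congr Finset.mem_product Iff.rfl) (and_congr Finset.mem_product Iff.rfl))
    (and_congr Finset.mem_product Iff.rfl)).symm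
  simp only [mem_rSet, mem_colSet]
  have := hs p.1.1; have := ht p.1.2; have := hr p.2
  have hu : p.2 ∈ (Finset.univ : Finset r.Conf) := Finset.mem_univ _
  simp only [hu, and_true]
  omega

/-- `#E(2,0) = a₁ a₂ n₃ + a₁ m₂ a₃ + m₁ a₂ a₃` with `m = a + c`, `n = 2a + c` -/
theorem tailCount_par3_20 (hs : FlowOne s) (ht : FlowOne t) (hr : FlowOne r) :
    tailCount (V2Closure.SP.par (V2Closure.SP.par s t) r) 2 0
      = (rSet s).card * (rSet t).card * (2 * (rSet r).card + (cellSet r).card)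
        + (rSet s).card * ((rSet t).card + (cellSet t).card) * (rSet r).card
        + ((rSet s).card + (cellSet s).card) * (rSet t).card * (rSet r).card := by
  rw [tailCount_eq_card, tailSet_par3_20 s t r hs ht hr]
  show ((((rSet s ×ˢ rSet t : Finset (s.Conf × t.Conf)) ×ˢ (Finset.univ : Finset r.Conf)
            : Finset ((s.Conf × t.Conf) × r.Conf))
          ∪ ((rSet s ×ˢ colSet t : Finset (s.Conf × t.Conf)) ×ˢ rSet r : Finset ((s.Conf × t.Conf) × r.Conf)))
          ∪ ((colSet s ×ˢ rSet t : Finset (s.Conf × t.Conf)) ×ˢ rSet r : Finset ((s.Conf × t.Conf) × r.Conf))).card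
        = _
  rw [Finset.card_union_of_disjoint, Finset.card_union_of_disjoint]
  · simp only [Finset.card_product, Finset.card_univ, card_conf_eq r hr, card_colSet' s hs, card_colSet' t ht]
  · rw [Finset.disjoint_left]; rintro ⟨⟨x, y⟩, z⟩ h1 h2
    simp only [Finset.mem_product, mem_rSet, mem_colSet, Finset.mem_univ, and_true] at h1 h2
    have := hs x; have := ht y; have := hr z; omega
  · rw [Finset.disjoint_left]; rintro ⟨⟨x, y⟩, z⟩ h1 h2
    simp only [Finset.mem_union, Finset.mem_product, mem_rSet, mem_colSet, Finset.mem_univ, and_true] at h1 h2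
    have := hs x; have := ht y; have := hr z; omega

/-- the tail `E(0,2)`: the first two blues — `BB·, B row B, row B B` -/
theorem tailSet_par3_02 (hs : FlowOne s) (ht : FlowOne t) (hr : FlowOne r) :
    tailSet (V2Closure.SP.par (V2Closure.SP.par s t) r) 0 2
      = (((bSet s ×ˢ bSet t : Finset (s.Conf × t.Conf)) ×ˢ (Finset.univ : Finset r.Conf)
            : Finset ((s.Conf × t.Conf) × r.Conf))
          ∪ ((bSet s ×ˢ rowSet t 0 : Finset (s.Conf × t.Conf)) ×ˢ bSet r : Finset ((s.Conf × t.Conf) × r.Conf)))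
          ∪ ((rowSet s 0 ×ˢ bSet t : Finset (s.Conf × t.Conf)) ×ˢ bSet r : Finset ((s.Conf × t.Conf) × r.Conf)) := by
  apply Finset.ext; intro p
  rw [mem_tailSet_par3]
  refine Iff.trans ?_ Finset.mem_union.symm
  refine Iff.trans ?_ (or_congr Finset.mem_union Iff.rfl).symm
  refine Iff.trans ?_ (or_congr (or_congr Finset.mem_product Finset.mem_product) Finset.mem_product).symm
  refine Iff.trans ?_ (or_congr (or_congr (and_congr Finset.mem_product Iff.rfl) (and_congr Finset.mem_product Iff.rfl))
    (and_congr Finset.mem_product Iff.rfl)).symm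
  simp only [mem_bSet, mem_rowSet0]
  have := hs p.1.1; have := ht p.1.2; have := hr p.2
  have hu : p.2 ∈ (Finset.univ : Finset r.Conf) := Finset.mem_univ _
  simp only [hu, and_true]
  omega

/-- `#E(0,2) = #E(2,0)` -/
theorem tailCount_par3_02 (hs : FlowOne s) (ht : FlowOne t) (hr : FlowOne r) :
    tailCount (V2Closure.SP.par (V2Closure.SP.par s t) r) 0 2
      = (rSet s).card * (rSet t).card * (2 * (rSet r).card + (cellSet r).card)
        + (rSet s).card * ((rSet t).card + (cellSet t).card) * (rSet r).card
        + ((rSet s).card + (cellSet s).card) * (rSet t).card * (rSet r).card := by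
  rw [tailCount_symm, tailCount_par3_20 s t r hs ht hr]

/-- the tail `E(1,1)` is everything but `{r = 0} ∪ {b = 0}`; its count by inclusion–exclusion:
`#E(1,1) + #col³ + #row³ = #all³ + #C³` -/
theorem tailCount_par3_11_add (hs : FlowOne s) (ht : FlowOne t) (hr : FlowOne r) :
    tailCount (V2Closure.SP.par (V2Closure.SP.par s t) r) 1 1
        + ((rSet s).card + (cellSet s).card) * ((rSet t).card + (cellSet t).card) * ((rSet r).card + (cellSet r).card)
        + ((rSet s).card + (cellSet s).card) * ((rSet t).card + (cellSet t).card) * ((rSet r).card + (cellSet r).card)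
      = (2 * (rSet s).card + (cellSet s).card) * (2 * (rSet t).card + (cellSet t).card)
          * (2 * (rSet r).card + (cellSet r).card)
        + (cellSet s).card * (cellSet t).card * (cellSet r).card := by
  -- the complement of `E(1,1)` is `{r = 0} ∪ {b = 0}`
  set Z := V2Closure.SP.par (V2Closure.SP.par s t) r
  set K : Finset ((s.Conf × t.Conf) × r.Conf) :=
    ((colSet s ×ˢ colSet t : Finset (s.Conf × t.Conf)) ×ˢ colSet r : Finset ((s.Conf × t.Conf) × r.Conf))
  set L : Finset ((s.Conf × t.Conf) × r.Conf) :=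
    ((rowSet s 0 ×ˢ rowSet t 0 : Finset (s.Conf × t.Conf)) ×ˢ rowSet r 0 : Finset ((s.Conf × t.Conf) × r.Conf))
  have hKL : K ∩ L = ((cellSet s ×ˢ cellSet t : Finset (s.Conf × t.Conf)) ×ˢ cellSet r
      : Finset ((s.Conf × t.Conf) × r.Conf)) := by
    ext ⟨⟨x, y⟩, z⟩
    simp only [K, L, Finset.mem_inter, Finset.mem_product, mem_colSet, mem_rowSet0, mem_cellSet]
    tauto
  have hcompl : tailSet Z 1 1 = (Finset.univ : Finset ((s.Conf × t.Conf) × r.Conf)) \ (K ∪ L) := by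
    apply Finset.ext; intro p
    rw [mem_tailSet_par3]
    refine Iff.trans ?_ Finset.mem_sdiff.symm
    refine Iff.trans ?_ (and_congr Iff.rfl (not_congr Finset.mem_union)).symm
    refine Iff.trans ?_ (and_congr Iff.rfl (not_congr (or_congr Finset.mem_product Finset.mem_product))).symm
    refine Iff.trans ?_ (and_congr Iff.rfl (not_congr (or_congr (and_congr Finset.mem_product Iff.rfl)
      (and_congr Finset.mem_product Iff.rfl)))).symm
    simp only [mem_colSet, mem_rowSet0]
    have := hs p.1.1; have := ht p.1.2; have := hr p.2
    constructor
    · intro h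
      refine ⟨Finset.mem_univ _, ?_⟩
      omega
    · rintro ⟨-, h⟩
      omega
  have hK : K.card = ((rSet s).card + (cellSet s).card) * ((rSet t).card + (cellSet t).card)
      * ((rSet r).card + (cellSet r).card) := by
    simp only [K, Finset.card_product, card_colSet' s hs, card_colSet' t ht, card_colSet' r hr]
  have hL : L.card = ((rSet s).card + (cellSet s).card) * ((rSet t).card + (cellSet t).card)
      * ((rSet r).card + (cellSet r).card) := by
    simp only [L, Finset.card_product, card_rowSet0' s hs, card_rowSet0' t ht, card_rowSet0' r hr]
  have hI : (K ∩ L).card = (cellSet s).card * (cellSet t).card * (cellSet r).card := by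
    rw [hKL]
    show ((cellSet s ×ˢ cellSet t : Finset (s.Conf × t.Conf)) ×ˢ cellSet r
      : Finset ((s.Conf × t.Conf) × r.Conf)).card = _
    rw [Finset.card_product, Finset.card_product]
  have hU : (K ∪ L).card + (K ∩ L).card = K.card + L.card := Finset.card_union_add_card_inter K L
  have hN : (Finset.univ : Finset ((s.Conf × t.Conf) × r.Conf)).card
      = (2 * (rSet s).card + (cellSet s).card) * (2 * (rSet t).card + (cellSet t).card)
          * (2 * (rSet r).card + (cellSet r).card) := by
    rw [Finset.card_univ, Fintype.card_prod, Fintype.card_prod, card_conf_eq s hs, card_conf_eq t ht,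
      card_conf_eq r hr]
  have hE : tailCount Z 1 1 = (Finset.univ : Finset ((s.Conf × t.Conf) × r.Conf)).card - (K ∪ L).card := by
    rw [tailCount_eq_card, hcompl]
    show ((Finset.univ : Finset ((s.Conf × t.Conf) × r.Conf)) \ (K ∪ L)).card = _
    rw [Finset.card_sdiff_of_subset (Finset.subset_univ _)]
  have hle : (K ∪ L).card ≤ (Finset.univ : Finset ((s.Conf × t.Conf) × r.Conf)).card :=
    Finset.card_le_univ _
  rw [hE]
  omega

end Three

section Pairs

variable (s t : V2Closure.SP)

/-- membership of a configuration of `s ∥ t` in a product block, with the membership taken on the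
configuration type of `s ∥ t` (so that it matches the blocks of a certificate on `(s ∥ t) ∥ r`) -/
theorem mem_pair_prod (X₁ : Finset s.Conf) (X₂ : Finset t.Conf) (q : (V2Closure.SP.par s t).Conf) :
    @Membership.mem (V2Closure.SP.par s t).Conf (Finset (V2Closure.SP.par s t).Conf) SetLike.instMembership
        (X₁ ×ˢ X₂) q ↔ q.1 ∈ X₁ ∧ q.2 ∈ X₂ :=
  Finset.mem_product

/-- the size of a product block, with the cardinality taken on the configuration type of `s ∥ t` -/
theorem card_pair_prod (X₁ : Finset s.Conf) (X₂ : Finset t.Conf) :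
    @Finset.card (V2Closure.SP.par s t).Conf (X₁ ×ˢ X₂) = X₁.card * X₂.card :=
  Finset.card_product _ _

/-- the red flow of a parallel composition, on a configuration -/
theorem rLab_par (q : (V2Closure.SP.par s t).Conf) : (V2Closure.SP.par s t).rLab q = s.rLab q.1 + t.rLab q.2 := rfl

/-- the blue flow of a parallel composition, on a configuration -/
theorem bLab_par (q : (V2Closure.SP.par s t).Conf) : (V2Closure.SP.par s t).bLab q = s.bLab q.1 + t.bLab q.2 := rfl

end Pairs

end Summit.Ventures.PercRepro2.Tail2D
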